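import Literature.AlgebraicGeometry.Frobenioids.BiratUnits
import Literature.AlgebraicGeometry.Frobenioids.IrreducibleMorphismsCounterexample
import HarnessLib

/-!
# Frobenioids I, Proposition 4.4: the refinement relation `RatFrac.Rel p q` on fractions presenting
# `O^×(A^birat)` (FACT-LIST F-0948) is a RELATION ON DATA — its universal closure is refutable (two
# distinct rational functions of the standard Frobenioid); its instance forms are the setoid laws

Mochizuki, *The geometry of Frobenioids I: the general theory*, Kyushu J. Math. **62** (2008)
293–400, §4, Proposition 4.4 p. 82 (`Hom^birat_C(A, B) := colim Hom_C(A', B)` over co-angular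
pre-steps `A' → A`; (ii) "the rational function monoid of the Frobenioid `C`"; (iv) base-identity
endomorphisms of `A^birat` as pairs `(α, φ)`) [cite: MochizukiFrdI2008, Prop. 4.4 p.82]; the standard
Frobenioid `F_{ℤ_{≥0}}` of Definition 1.1 (iii) p. 20 [cite: MochizukiFrdI2008, Def. 1.1(iii) p.20].

Negative knowledge recorded next to `BiratUnits.lean` (abc-iut-L1, p405775), PROOF-ONLY (no definition,
no instance), abc-iut cell seat abc-iut-f-024 (block F, FACT-LIST row **F-0948**
`PreFrobenioid.RatFrac.Rel`; class `preparatory`, kernel_closedness `parametrised`; FACT-LIST status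
«conditional(G: RatFrac.Rel.trans)» was a witness-scan head match on the transitivity law).

`RatFrac.Rel p q` — "`(α, φ) ∼ (α', φ')` iff `ε ≫ α = ε' ≫ α'` and `ε ≫ φ = ε' ≫ φ'` for some
co-angular pre-steps `ε, ε'`" — is the equivalence relation whose quotient IS `O^×(A^birat)`
(`BiratUnits F hF A := Quotient (RatFrac.setoid F hF A)`): a PARAMETRISED predicate in the two
fractions `p, q`.  It is never bound as a hypothesis of a cone node; its INSTANCE forms are the setoid
laws already in the tree — `RatFrac.Rel.refl`, `RatFrac.Rel.symm`, `RatFrac.Rel.trans`,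
`RatFrac.setoid`, and the congruences `mul_rel_left` / `mul_rel_right` / `inv_rel` / `mulWith_rel`
(`BiratUnits.lean`).  The UNIVERSAL closure ("any two fractions at `A` are refinement-equivalent",
i.e. "`O^×(A^birat)` is trivial for every `A` of every pre-Frobenioid") is false, and this file
supplies the kernel object inside a GENUINE Frobenioid, the standard Frobenioid `F_{ℤ_{≥0}} → F_{ℤ_{≥0}^char}`
of Def. 1.1 (iii) (`StandardFrobenioidExample.Φst`, a Frobenioid by Prop. 1.5 (i):
`StandardFrobenioidExample.isFrobenioid`), at its unique object `A = ⋆`: the fractions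
`𝟙 = (id, id)` and `(id, (id, 1, 1))` ("the rational function with divisor `1 ∈ ℤ = (ℤ_{≥0})^gp`")
are NOT related, because a common refinement `ε = ε ≫ (id, 1, 1)` would force
`Div(ε) = 1 + Div(ε)` in `ℤ_{≥0}`:

* `StandardFrobenioidExample.not_rel_one_stepOne` (the two fractions), hence
  `StandardFrobenioidExample.mk_stepOne_ne_one` (`O^×(⋆^birat) ≠ 1`: the class of `(id, (id,1,1))` is
  not the unit) and `StandardFrobenioidExample.exists_ratFrac_not_rel`;
* `PreFrobenioid.RatFrac.not_forall_rel` — the fully quantified closure (level `0`) is FALSE;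
* `PreFrobenioid.RatFrac.rel_mk_mk_iff_of_den_eq` — the general instance-level content: in a Frobenioid,
  `(α, φ) ∼ (α, ψ) ↔ φ = ψ` (co-angular pre-steps are monomorphisms, `C` is totally epimorphic — the
  injectivity of the transition maps of the colimit `Hom^birat_C(A, A)`, p. 84).
* (v2) `PreFrobenioid.RatFrac.rel_one_iff_den_eq_num` / `PreFrobenioid.BiratUnits.mk_eq_one_iff` /
  `BiratUnits.mk_ne_one_of_den_ne_num` — in a Frobenioid, `[(α, φ)] = 1` in `O^×(A^birat)` iff `α = φ`.

So the row is admissible ONLY as vocabulary (FACT-LIST class «universal-closure REFUTED / schema;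
instance forms PROVED» — the instance forms being the setoid laws cited above).  Elementary; nothing
here bears on the disputed [IUTchIII] Cor. 3.12 or takes a side; refuted-as-schema is a statement about
OUR typing, not about the paper (whose `O^×(A^birat)` is of course non-trivial in general — that is the
point of the rational function monoid).
-/

namespace Literature.AlgebraicGeometry.Frobenioids

open CategoryTheory Opposite

universe w v v' u u'

/-! ### Instance form: fractions with a common denominator -/

namespace PreFrobenioid.RatFrac

variable {D : Type u} [Category.{v} D] {Φ : Dᵒᵖ ⥤ CommMonCat.{w}}
  {C : Type u'} [Category.{v'} C] {F : C ⥤ ElemFrobenioid Φ}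

/-- **F-0948, instance form (injectivity of the transition maps of `Hom^birat`):** in a Frobenioid, two
fractions `(α, φ)`, `(α, ψ)` with the SAME denominator are refinement-equivalent iff `φ = ψ` — a relating
pair `ε ≫ α = ε' ≫ α` has `ε = ε'` because the co-angular pre-step `α` is a monomorphism (Def. 1.3 (v)(a)),
and then `ε ≫ φ = ε ≫ ψ` gives `φ = ψ` because `C` is totally epimorphic (p. 84: "since [a co-angular
pre-step] is a monomorphism …"). [cite: MochizukiFrdI2008, Prop. 4.4 p.82] -/
theorem rel_mk_mk_iff_of_den_eq (hF : IsFrobenioid F) {A X : C} (α φ ψ : X ⟶ A)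
    (hα : IsCoAngularPreStep F α) (hφ : IsCoAngularPreStep F φ) (hψ : IsCoAngularPreStep F ψ)
    (eφ : BaseEquivalent F α φ) (eψ : BaseEquivalent F α ψ) :
    Rel ⟨X, α, φ, hα, hφ, eφ⟩ ⟨X, α, ψ, hα, hψ, eψ⟩ ↔ φ = ψ := by
  refine ⟨?_, ?_⟩
  · rintro ⟨E, ε, ε', -, -, h₁, h₂⟩
    dsimp only at ε ε' h₁ h₂
    haveI : Mono α := hα.mono hF
    have hε : ε = ε' := (cancel_mono α).mp h₁
    subst hε
    haveI : Epi ε := hF.isPreFrobenioid.isTotallyEpimorphic.epi ε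
    exact (cancel_epi ε).mp h₂
  · rintro rfl
    exact Rel.refl hF _

end PreFrobenioid.RatFrac

/-! ### The witness in the standard Frobenioid `F_{ℤ_{≥0}}` -/

namespace StandardFrobenioidExample

/-- `(id, 1, 1) : ⋆ → ⋆` is a co-angular pre-step of the standard Frobenioid (every arrow of an
elementary Frobenioid is co-angular, Prop. 1.5). [cite: MochizukiFrdI2008, Prop. 1.5(i) p.27] -/
theorem isCoAngularPreStep_stepOne (X : ElemFrobenioid Φst) :
    PreFrobenioid.IsCoAngularPreStep (ElemFrobenioid.toChar Φst) (stepOne X) :=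
  ⟨ElemFrobenioid.isCoAngular _, isPreStep_stepOne X⟩

/-- The identity of an object of the standard Frobenioid is a co-angular pre-step.
[cite: MochizukiFrdI2008, Prop. 1.5(i) p.27] -/
theorem isCoAngularPreStep_id (X : ElemFrobenioid Φst) :
    PreFrobenioid.IsCoAngularPreStep (ElemFrobenioid.toChar Φst) (𝟙 X) :=
  ⟨ElemFrobenioid.isCoAngular _, ElemFrobenioid.isPreStep_id X⟩

/-- **F-0948, universal closure false (in a genuine Frobenioid):** in the standard Frobenioid, the unit
fraction `(id, id)` at `⋆` and the fraction `(id, (id, 1, 1))` (denominator `id`, numerator the pre-step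
with zero divisor `1`) admit NO common refinement: `ε ≫ id = ε' ≫ id` and `ε ≫ id = ε' ≫ (id, 1, 1)` give
`Div(ε) = 1 + Div(ε)` in `ℤ_{≥0}`. [cite: MochizukiFrdI2008, Prop. 4.4 p.82] -/
theorem not_rel_one_stepOne :
    ¬ PreFrobenioid.RatFrac.Rel (PreFrobenioid.RatFrac.one isFrobenioid A)
        ⟨A, 𝟙 A, stepOne A, isCoAngularPreStep_id A, isCoAngularPreStep_stepOne A, rfl⟩ := by
  rintro ⟨E, ε, ε', -, -, h₁, h₂⟩
  dsimp only [PreFrobenioid.RatFrac.one] at ε ε' h₁ h₂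
  rw [Category.comp_id, Category.comp_id] at h₁
  subst h₁
  rw [Category.comp_id] at h₂
  have h := congrArg dv h₂
  rw [dv_comp, dv_stepOne, degFr_stepOne, PNat.one_coe, one_mul] at h
  omega

/-- **F-0948:** hence there are two fractions at `⋆` that are not refinement-equivalent.
[cite: MochizukiFrdI2008, Prop. 4.4 p.82] -/
theorem exists_ratFrac_not_rel :
    ∃ p q : PreFrobenioid.RatFrac (ElemFrobenioid.toChar Φst) A, ¬ p.Rel q :=
  ⟨_, _, not_rel_one_stepOne⟩

/-- **F-0948, read in `O^×(A^birat)`:** the class of `(id, (id, 1, 1))` in `O^×(⋆^birat)` of the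
standard Frobenioid is not the unit — "the rational function monoid" (Prop. 4.4 (ii)) of `F_{ℤ_{≥0}}`
is non-trivial (it is `ℤ = (ℤ_{≥0})^gp`; only `≠ 1` is recorded here). [cite: MochizukiFrdI2008,
Prop. 4.4(ii) p.83] -/
theorem mk_stepOne_ne_one :
    PreFrobenioid.BiratUnits.mk isFrobenioid
        (⟨A, 𝟙 A, stepOne A, isCoAngularPreStep_id A, isCoAngularPreStep_stepOne A, rfl⟩ :
          PreFrobenioid.RatFrac (ElemFrobenioid.toChar Φst) A) ≠ 1 := by
  intro h
  rw [PreFrobenioid.BiratUnits.one_def, PreFrobenioid.BiratUnits.mk_eq_mk_iff] at h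
  exact not_rel_one_stepOne h.symm

end StandardFrobenioidExample

/-! ### F-0948 as a schema is not a fact -/

namespace PreFrobenioid

/-- **F-0948 as a schema is not a fact:** the fully quantified closure of `PreFrobenioid.RatFrac.Rel`
(over all bases, divisor monoids, pre-Frobenioid structure functors, objects and pairs of fractions, at
universe level `0`) is FALSE — refuted inside the standard Frobenioid
(`StandardFrobenioidExample.not_rel_one_stepOne`).  What the paper uses are the setoid laws
`RatFrac.Rel.refl` / `Rel.symm` / `Rel.trans` (the colimit `Hom^birat` is over a directed system).
[cite: MochizukiFrdI2008, Prop. 4.4 p.82] -/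
theorem RatFrac.not_forall_rel :
    ¬ ∀ {D : Type} [Category.{0} D] {Φ : Dᵒᵖ ⥤ CommMonCat.{0}} {C : Type} [Category.{0} C]
        {F : C ⥤ ElemFrobenioid Φ} {A : C} (p q : RatFrac F A), p.Rel q :=
  fun h => StandardFrobenioidExample.not_rel_one_stepOne (h _ _)

end PreFrobenioid

/-! ### Instance form (v2 append): which fractions present the unit of `O^×(A^birat)` -/

namespace PreFrobenioid

variable {D : Type u} [Category.{v} D] {Φ : Dᵒᵖ ⥤ CommMonCat.{w}}
  {C : Type u'} [Category.{v'} C] {F : C ⥤ ElemFrobenioid Φ}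

/-- **F-0948, instance form (triviality criterion):** in a Frobenioid, a fraction `(α, φ)` is
refinement-equivalent to the unit fraction `(id, id)` iff `α = φ` — a relating pair gives
`ε ≫ α = ε' = ε ≫ φ`, and `ε` is an epimorphism (`C` totally epimorphic); conversely `(α, α) ∼ (id, id)`
via `(ε, ε') = (id, α)`.  I.e. the birational automorphism "`φ ∘ α⁻¹`" of `A^birat` is the identity iff
`φ = α` (cf. Prop. 4.4 (ii): `C → C^birat` is faithful). [cite: MochizukiFrdI2008, Prop. 4.4 p.82] -/
theorem RatFrac.rel_one_iff_den_eq_num (hF : IsFrobenioid F) {A : C} (p : RatFrac F A) :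
    p.Rel (RatFrac.one hF A) ↔ p.den = p.num := by
  refine ⟨?_, fun h => ?_⟩
  · rintro ⟨E, ε, ε', -, -, h₁, h₂⟩
    dsimp only [RatFrac.one] at ε' h₁ h₂
    rw [Category.comp_id] at h₁ h₂
    haveI : Epi ε := hF.isPreFrobenioid.isTotallyEpimorphic.epi ε
    exact (cancel_epi ε).mp (h₁.trans h₂.symm)
  · refine ⟨p.src, 𝟙 _, p.den, isCoAngularPreStep_id hF _, p.den_mem, ?_, ?_⟩
    · show 𝟙 _ ≫ p.den = p.den ≫ 𝟙 A
      rw [Category.id_comp, Category.comp_id]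
    · show 𝟙 _ ≫ p.num = p.den ≫ 𝟙 A
      rw [Category.id_comp, Category.comp_id, h]

/-- **F-0948, read in `O^×(A^birat)`:** the class of `(α, φ)` is the unit of `O^×(A^birat)` iff `α = φ`.
[cite: MochizukiFrdI2008, Prop. 4.4(ii) p.83] -/
theorem BiratUnits.mk_eq_one_iff {hF : IsFrobenioid F} {A : C} (p : RatFrac F A) :
    BiratUnits.mk hF p = 1 ↔ p.den = p.num := by
  rw [BiratUnits.one_def, BiratUnits.mk_eq_mk_iff]
  exact RatFrac.rel_one_iff_den_eq_num hF p

/-- **F-0948:** consequently two distinct base-equivalent co-angular pre-steps `α ≠ φ : X → A` of a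
Frobenioid always give a NON-trivial rational function `[(α, φ)] ≠ 1` — the general form of the
standard-Frobenioid witness `StandardFrobenioidExample.mk_stepOne_ne_one`.
[cite: MochizukiFrdI2008, Prop. 4.4(ii) p.83] -/
theorem BiratUnits.mk_ne_one_of_den_ne_num {hF : IsFrobenioid F} {A : C} (p : RatFrac F A)
    (h : p.den ≠ p.num) : BiratUnits.mk hF p ≠ 1 :=
  fun h1 => h ((BiratUnits.mk_eq_one_iff p).mp h1)

end PreFrobenioid

end Literature.AlgebraicGeometry.Frobenioids
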